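import Literature.Barriers.CriticalPhenomena.NoExactBoundaryRelationZ2
import HarnessLib

/-!
# Barrier supplement: the strip form of `NoExactBoundaryRelationZ2` at FIXED width — width `2` already refuses

Companion of `Literature.Barriers.CriticalPhenomena.NoExactBoundaryRelationZ2` (Appendix S there: no
exact Beaton–Guttmann–Jensen-type identity `c₀ x + c_W A + c_E B + c_N E + c_S Ē = 0` with constant
coefficients on all `ℤ²` rectangles). Beaton–Guttmann–Jensen's constants are allowed to depend on the
WIDTH `T` of the strip: "on the square and triangular lattices with appropriate changes in these
constants … `1 = c_α(T) A_T(z_c) + c_β(T) B_T(z_c)` … weakly `T`-dependent" (J. Phys. A 45 (2012)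
035201, p. 5). The fixed-width form of the class is therefore the relevant one, and it is settled here:

* `ExactStripRelationZ2W W x c₀ c`: the strip identity demanded only on the rectangles of width `W`
  (every height `H`, every west pendant root), in the vocabulary of the parent module
  (`stripFunctionalZ2`);
* **`exactStripRelationZ2W_two_eq_zero`**: for every real `x ≠ 0`, width `W = 2` already forces
  `c₀ = 0 ∧ c = 0` — seven rectangles (`2×1`; `2×2` both roots; `2×3` three roots; `2×4` bottom root)
  and explicit polynomial certificates of degree `≤ 7` (`Σ_r λ_{j,r}(x)·row_r = x⁷ e_j`, found and
  verified by exact linear algebra over `ℚ`, checked by `linear_combination`);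
* `exactStripRelationZ2_eq_zero_of_width_two`: the parent module's all-widths statement re-derived.

Width `1` is genuinely different: on a single column `{0} × {0..H-1}` the reflection fixing the root row
gives `B = A + x` for every `H` and root, and `x(E + Ē) + (1 - x)A = 2x²` holds as well (elementary
counting; checked exactly for `H ≤ 8`, not formalised) — so the fixed-width class is NOT empty at
`W = 1`, and `W = 2` is the first width at which the square lattice refuses.

Implementation note. The parent module's evaluation lemmas (`boundaryFunctional_eq` & co.) are private
— uncited helper statements must be (gate lint) — and the parent file sits at the gate's size cap, so
the helpers needed here are repeated verbatim below as private lemmas of this module; the kernel data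
(`NoBoundaryRelation.rowTerms`, `dfs`, `boxCells`, the edge lists `ES210 …`) are the parent's public
definitions.
-/

noncomputable section

open Real

namespace Literature.Barriers.CriticalPhenomena

open Literature.Probability.RandomPlanarGeometry.SAW Literature.Probability.LatticeModels
  Literature.Probability.Percolation

/-- **Technique class, strip form at fixed width `W`.** As `ExactStripRelationZ2`, but the identity
`stripFunctionalZ2 … = 0` is demanded only on the rectangles `{0..W-1} × {0..H-1}` of the given width `W`
(every height `H`, every west pendant root `(-1, j)`), matching Beaton–Guttmann–Jensen's width-by-width
constants `c_α(T), c_β(T)`. [cite: BeatonGuttmannJensen2012, p. 5 (`T`-dependent constants)] -/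
def ExactStripRelationZ2W (W : ℕ) (x : ℝ) (c₀ : ℂ) (c : Fin 4 → ℂ) : Prop :=
  ∀ (Ω : Set ℂ) (δ : ℝ) (V : Finset (Site 2)) (H j : ℕ), 0 < δ → j < H →
    (∀ z, z ∈ V ↔ z ∈ meshDomain Ω δ) →
    (∀ z, z ∈ V ↔ (0 ≤ z 0 ∧ z 0 < W ∧ 0 ≤ z 1 ∧ z 1 < H) ∨ z = NoVertexRelation.toSite (-1, (j : ℤ))) →
    (∀ z z', (discreteDomainGraph Ω δ).Adj z z' ↔ z ∈ V ∧ z' ∈ V ∧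
        NoVertexRelation.IsUnitStep (NoVertexRelation.dirOf (NoVertexRelation.ofSite z) (NoVertexRelation.ofSite z'))) →
      stripFunctionalZ2 Ω δ V (NoVertexRelation.toSite (-1, (j : ℤ))) (NoVertexRelation.toSite (0, (j : ℤ))) x c₀ c = 0

/-- The all-widths class implies each fixed-width class. [cite: BeatonGuttmannJensen2012, p. 5] -/
theorem ExactStripRelationZ2.width {x : ℝ} {c₀ : ℂ} {c : Fin 4 → ℂ} (h : ExactStripRelationZ2 x c₀ c)
    {W : ℕ} (hW : 0 < W) : ExactStripRelationZ2W W x c₀ c :=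
  fun Ω δ V H j hδ hj hV hbox hadj => h Ω δ V W H j hδ hW hj hV hbox hadj

/-! ### Private copies of the parent module's evaluation lemmas -/


namespace NoBoundaryRelation

open NoVertexRelation Complex

variable {E : List (ZZ × ZZ)}

/-! ### Integer-coordinate bookkeeping -/

/-- `dirZ2` in integer coordinates. [folklore] -/
private theorem toSite_add_dirZ2 (p : ZZ) (i : Fin 4) : toSite p + dirZ2 i = toSite (p + dirZZ i) := by
  fin_cases i <;> (funext j; fin_cases j <;> simp [toSite, dirZ2, dirZZ])

/-- Membership in `vertsFinset`, integer coordinates. [folklore] -/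
private theorem toSite_mem_vertsFinset_iff (p : ZZ) : toSite p ∈ vertsFinset E ↔ p ∈ verts E := by
  simp only [vertsFinset, List.mem_toFinset, List.mem_map]
  constructor
  · rintro ⟨q, hq, h⟩; rwa [← toSite_injective h]
  · exact fun h => ⟨p, h, rfl⟩

/-- Membership in `vertsFinset`. [folklore] -/
private theorem mem_vertsFinset_iff' (z : Site 2) : z ∈ vertsFinset E ↔ ofSite z ∈ verts E := by
  rw [← toSite_mem_vertsFinset_iff, toSite_ofSite]

/-- For a good edge list, `vertsFinset E` is the vertex set of the discrete domain `meshDomain (Ω_E) 1`. [folklore] -/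
private theorem mem_vertsFinset_iff (hG : GoodEdgeList E) (z : Site 2) :
    z ∈ vertsFinset E ↔ z ∈ meshDomain (Omega E) 1 := by
  rw [mem_vertsFinset_iff', hG.mem_meshDomain_iff]

/-- A vertex whose neighbour list is a singleton is a leaf of `Ω_E`. [folklore] -/
private theorem leaf_of_nbrs (hG : GoodEdgeList E) {r w₁ : ZZ} (h : nbrs E r = [w₁]) :
    ∀ w, (discreteDomainGraph (Omega E) 1).Adj (toSite r) w → w = toSite w₁ := by
  intro w hw
  have h1 : EAdj E r (ofSite w) := by simpa using (hG.adj_iff (toSite r) w).1 hw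
  have h2 : ofSite w ∈ nbrs E r := mem_nbrs_iff.2 h1
  rw [h] at h2
  rw [← toSite_ofSite w, List.mem_singleton.1 h2]

/-! ### Enumeration data (kernel-computable) -/

/-- The phase of an integer number of quarter turns. [folklore] -/
private theorem cexp_quarter_int (σ : ℝ) (m : ℤ) :
    Complex.exp (-Complex.I * σ * (((m : ℤ) : ℝ) * (Real.pi / 2) : ℝ)) = tpow (tOf σ) m := by
  unfold tpow
  split_ifs with h
  · obtain ⟨k, rfl⟩ := Int.eq_ofNat_of_zero_le h
    rw [cexp_quarter_nat]; simp
  · obtain ⟨k, hk⟩ := Int.exists_eq_neg_ofNat (le_of_lt (not_le.1 h))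
    subst hk
    rw [cexp_quarter_neg_nat]; simp

/-! ### Walks from chains (soundness of the enumeration) -/

/-- Support of the chain walk. [folklore] -/
private theorem support_mkWalk (hG : GoodEdgeList E) : ∀ (v : ZZ) (l : List ZZ) (h : chainB E v l = true),
    (mkWalk hG v l h).support = (v :: l).map toSite
  | _, [], _ => rfl
  | v, w :: rest, h => by
    simp only [mkWalk, SimpleGraph.Walk.support_cons, List.map_cons, List.cons.injEq, true_and]
    exact support_mkWalk hG w rest _

/-- A certified reversed vertex list is the support of a self-avoiding walk `r → z`. [folklore] -/
private theorem exists_saw_of_pathOK (hG : GoodEdgeList E) {r z : ZZ} {l : List ZZ} (h : pathOK E r z l = true) :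
    ∃ γ : DomainSAW (Omega E) 1 (toSite r) (toSite z), (γ.walk.support.map ofSite).reverse = l := by
  unfold pathOK at h
  split at h
  · simp at h
  · rename_i v rest hrev
    simp only [Bool.and_eq_true, decide_eq_true_eq] at h
    obtain ⟨⟨⟨rfl, hch⟩, hlast⟩, hnd⟩ := h
    subst hlast
    refine ⟨⟨mkWalk hG v rest hch, ?_⟩, ?_⟩
    · rw [SimpleGraph.Walk.isPath_def, support_mkWalk]
      exact hnd.map toSite_injective
    · change ((mkWalk hG v rest hch).support.map ofSite).reverse = l
      rw [support_mkWalk, List.map_map]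
      have : (ofSite ∘ toSite) = id := funext ofSite_toSite
      rw [this, List.map_id, ← hrev, List.reverse_reverse]

/-! ### Evaluating half-edge terms by the enumeration -/

/-- No walk of `Ω_E` from a vertex reaches a non-vertex. [folklore] -/
private theorem isEmpty_saw_of_not_mem (hG : GoodEdgeList E) {r w : ZZ} (hr : r ∈ verts E) (hw : w ∉ verts E) :
    IsEmpty (DomainSAW (Omega E) 1 (toSite r) (toSite w)) := by
  refine ⟨fun γ => hw ?_⟩
  have hadj : ∀ s t, (discreteDomainGraph (Omega E) 1).Adj s t → EAdj E (ofSite s) (ofSite t) :=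
    fun s t h => (hG.adj_iff s t).1 h
  have := support_subset_verts _ hadj γ.walk (by simpa using hr) (toSite w) γ.walk.end_mem_support
  simpa using this

/-- The half-edge term INTO the domain from a non-vertex vanishes (no walk ends outside). [folklore] -/
private theorem halfEdgeTerm_out (hG : GoodEdgeList E) {r w : ZZ} (hr : r ∈ verts E) (hw : w ∉ verts E)
    (x σ : ℝ) (z : ZZ) :
    halfEdgeTerm (Omega E) 1 (toSite r) x σ (toSite w) (toSite z) = 0 := by
  haveI := isEmpty_saw_of_not_mem hG hr hw
  unfold halfEdgeTerm
  exact tsum_empty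

/-- The root's own half-edge term: only the trivial walk, `F = x`. [folklore] -/
private theorem halfEdgeTerm_self (Ω : Set ℂ) (δ : ℝ) (a w : Site 2) (x σ : ℝ) :
    halfEdgeTerm Ω δ a x σ a w = x := by
  unfold halfEdgeTerm
  rw [tsum_fintype, Fintype.sum_unique, DomainSAW.eq_nil_of_self default]
  simp [DomainSAW.nil, DomainSAW.length]

/-- Towards a leaf root every walk uses the pendant edge: the inward half-edge term at the root edge vanishes. [folklore] -/
private theorem halfEdgeTerm_leaf {Ω : Set ℂ} {δ : ℝ} {a w₁ : Site 2}
    (hadj : (discreteDomainGraph Ω δ).Adj w₁ a)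
    (hleaf : ∀ w, (discreteDomainGraph Ω δ).Adj a w → w = w₁) (x σ : ℝ) :
    halfEdgeTerm Ω δ a x σ w₁ a = 0 := by
  refine halfEdgeTerm_eq_zero x σ a fun γ => ?_
  obtain ⟨p, hp⟩ := γ
  cases p with
  | nil => exact absurd rfl hadj.ne
  | cons h q =>
    rename_i w
    have hw : w = w₁ := hleaf w h
    subst hw
    simp [SimpleGraph.Walk.edges_cons, Sym2.eq_swap]

/-- Summation over a `flatMap`. [folklore] -/
private theorem sum_flatMap {α β : Type*} (L : List α) (f : α → List β) (g : β → ℂ) :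
    ((L.flatMap f).map g).sum = (L.map fun a => ((f a).map g).sum).sum := by
  induction L with
  | nil => simp
  | cons a L ih => simp [List.flatMap_cons, ih]

/-- **Evaluation of a boundary half-edge term by the path enumeration.** For a vertex `z` of `Ω_E`
and a non-vertex lattice neighbour `w`, the half-edge term `z → w` of the observable rooted at the
vertex `r` is the sum, over the certified complete duplicate-free list of simple paths `r → z`, of
`x^{#vertices} t^{quarter turns}`, `t = e^{-iσπ/2}`. [folklore] -/
private theorem halfEdgeTerm_eq_pathSum (hG : GoodEdgeList E) {r z w : ZZ} (hr : r ∈ verts E)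
    (hw : w ∉ verts E) {fuel : ℕ} (hfuel : (verts E).length ≤ fuel)
    (hok : ∀ l ∈ pathsTo E fuel r z, pathOK E r z l = true ∧ goodSteps (l.reverse ++ [w]) = true)
    (hnd : (pathsTo E fuel r z).Nodup) (x σ : ℝ) :
    halfEdgeTerm (Omega E) 1 (toSite r) x σ (toSite z) (toSite w) =
      ((pathsTo E fuel r z).map fun l => (x : ℂ) ^ l.length * tpow (tOf σ) (quarterTurns (l.reverse ++ [w]))).sum := by
  classical
  set P := pathsTo E fuel r z with hP
  let S := DomainSAW (Omega E) 1 (toSite r) (toSite z)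
  let φ : S → List ZZ := fun γ => (γ.walk.support.map ofSite).reverse
  have hφmem : ∀ γ : S, φ γ ∈ P := by
    intro γ
    simp only [hP, pathsTo, List.mem_filter, decide_eq_true_eq]
    refine ⟨by simpa using hG.support_mem_dfs γ (by simpa using hr) hfuel, ?_⟩
    show ((γ.walk.support.map ofSite).reverse).head? = some z
    rw [head?_reverse_map_support, ofSite_toSite]
  have hφinj : Function.Injective φ := by
    intro γ γ' h
    apply DomainSAW_eq_of_support
    have h' := congrArg List.reverse h
    simp only [φ, List.reverse_reverse] at h'
    exact List.map_injective_iff.2 ofSite_injective h'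
  haveI : Finite S := Finite.of_injective (fun γ => (⟨φ γ, hφmem γ⟩ : {l // l ∈ P})) fun γ γ' h =>
    hφinj (congrArg Subtype.val h)
  haveI : Fintype S := Fintype.ofFinite S
  let g : List ZZ → ℂ := fun l => (x : ℂ) ^ l.length * tpow (tOf σ) (quarterTurns (l.reverse ++ [w]))
  have hterm : ∀ γ : S,
      (if s(toSite z, toSite w) ∈ γ.walk.edges then 0 else
        Complex.exp (-Complex.I * σ *
          (winding (γ.walk.support.map (meshPoint 1) ++ [medialPoint 1 s(toSite z, toSite w)]) : ℝ)) *
          (x : ℂ) ^ (γ.length + 1)) = g (φ γ) := by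
    intro γ
    have hnot : s(toSite z, toSite w) ∉ γ.walk.edges := by
      intro he
      have hws : toSite w ∈ γ.walk.support := SimpleGraph.Walk.snd_mem_support_of_mem_edges _ he
      have hadj : ∀ s t, (discreteDomainGraph (Omega E) 1).Adj s t → EAdj E (ofSite s) (ofSite t) :=
        fun s t h => (hG.adj_iff s t).1 h
      have := support_subset_verts _ hadj γ.walk (by simpa using hr) _ hws
      exact hw (by simpa using this)
    rw [if_neg hnot]
    have hgood : goodSteps (γ.walk.support.map ofSite ++ [ofSite (toSite w)]) = true := by
      have := (hok (φ γ) (hφmem γ)).2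
      simpa [φ] using this
    rw [winding_support_medial γ.walk (toSite w) hgood, cexp_quarter_int]
    have hlen : (φ γ).length = γ.length + 1 := by
      simp [φ, DomainSAW.length, SimpleGraph.Walk.length_support]
    have hrev : (φ γ).reverse ++ [w] = γ.walk.support.map ofSite ++ [ofSite (toSite w)] := by
      simp [φ]
    simp only [g, hlen, hrev]
    ring
  unfold halfEdgeTerm
  rw [tsum_fintype]
  rw [show ∑ γ : S, _ = ∑ γ : S, g (φ γ) from Finset.sum_congr rfl fun γ _ => hterm γ]
  rw [← List.sum_toFinset g hnd]
  refine Finset.sum_bij (fun γ _ => φ γ) (fun γ _ => List.mem_toFinset.2 (hφmem γ))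
    (fun γ _ γ' _ h => hφinj h) (fun l hl => ?_) (fun γ _ => rfl)
  obtain ⟨γ, hγ⟩ := exists_saw_of_pathOK hG (hok l (List.mem_toFinset.1 hl)).1
  exact ⟨γ, Finset.mem_univ _, hγ⟩

/-! ### Evaluating the boundary functional on `Ω_E` -/

/-- The boundary double sum of `boundaryFunctionalZ2` on `Ω_E`, as a list sum over `bdry E r`. [folklore] -/
private theorem sum_boundary (r : ZZ) (G : Site 2 → Fin 4 → ℂ) :
    (∑ z ∈ (vertsFinset E).erase (toSite r), ∑ i : Fin 4,
        if z + dirZ2 i ∈ vertsFinset E then 0 else G z i) =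
      ((bdry E r).map fun pi => G (toSite pi.1) pi.2).sum := by
  classical
  have hset : (vertsFinset E).erase (toSite r) =
      (((verts E).dedup.filter fun p => p ≠ r).map toSite).toFinset := by
    ext z
    simp only [Finset.mem_erase, mem_vertsFinset_iff', List.mem_toFinset, List.mem_map,
      List.mem_filter, List.mem_dedup, decide_eq_true_eq]
    constructor
    · rintro ⟨hne, hmem⟩
      exact ⟨ofSite z, ⟨hmem, fun h => hne (by rw [← toSite_ofSite z, h])⟩, toSite_ofSite z⟩
    · rintro ⟨p, ⟨hp, hne⟩, rfl⟩
      exact ⟨fun h => hne (toSite_injective h), by simpa using hp⟩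
  have hnd : (((verts E).dedup.filter fun p => p ≠ r).map toSite).Nodup :=
    (((verts E).nodup_dedup).filter _).map toSite_injective
  rw [hset, List.sum_toFinset _ hnd, bdry, sum_flatMap, List.map_map]
  congr 1
  refine List.map_congr_left fun p _ => ?_
  simp only [Function.comp_apply]
  have h4 : ∀ (h : Fin 4 → ℂ), ∑ i : Fin 4, h i = ((List.finRange 4).map h).sum := by
    intro h; simp [Fin.sum_univ_four, List.finRange_succ, List.sum_cons, add_assoc]
  rw [h4]
  generalize List.finRange 4 = L
  induction L with
  | nil => simp
  | cons i L ih =>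
    by_cases hi : p + dirZZ i ∈ verts E
    · have : toSite p + dirZ2 i ∈ vertsFinset E := by
        rw [toSite_add_dirZ2, toSite_mem_vertsFinset_iff]; exact hi
      simp [hi, this, ih]
    · have : toSite p + dirZ2 i ∉ vertsFinset E := by
        rw [toSite_add_dirZ2, toSite_mem_vertsFinset_iff]; exact hi
      simp [hi, this, ih]

/-- Members of `bdry E r` point out of the domain, from a vertex. [folklore] -/
private theorem mem_bdry {r : ZZ} {pi : ZZ × Fin 4} (h : pi ∈ bdry E r) :
    pi.1 ∈ verts E ∧ pi.1 + dirZZ pi.2 ∉ verts E := by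
  simp only [bdry, List.mem_flatMap, List.mem_filter, List.mem_map, List.mem_dedup,
    decide_eq_true_eq, List.mem_finRange, true_and] at h
  obtain ⟨p, ⟨hp, -⟩, i, hi, rfl⟩ := h
  exact ⟨hp, hi⟩

/-- **The boundary functional on `Ω_E` rooted at a leaf `r`**, evaluated by the enumeration:
`B(d) = d_{i₀} x + Σ_{(i,n,m) ∈ rowTerms} d_i x^n t^m`. [folklore] -/
private theorem boundaryFunctional_eq (hG : GoodEdgeList E) {r w₁ : ZZ} (i₀ : Fin 4) (hr : r ∈ verts E)
    (hnb : nbrs E r = [w₁]) {fuel : ℕ} (hfuel : (verts E).length ≤ fuel)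
    (hok : rowOK E fuel r = true) (x σ : ℝ) (d : Fin 4 → ℂ) :
    boundaryFunctionalZ2 (Omega E) 1 (vertsFinset E) (toSite r) (toSite w₁) i₀ x σ d =
      d i₀ * x + ((rowTerms E fuel r).map fun inm =>
        d inm.1 * ((x : ℂ) ^ inm.2.1 * tpow (tOf σ) inm.2.2)).sum := by
  have hadj : (discreteDomainGraph (Omega E) 1).Adj (toSite w₁) (toSite r) :=
    hG.A w₁ r (mem_nbrs_iff.1 (by rw [hnb]; simp)).symm
  have hleaf := leaf_of_nbrs hG hnb
  unfold boundaryFunctionalZ2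
  rw [midEdgeParafermionicObservable_mk, halfEdgeTerm_leaf hadj hleaf, halfEdgeTerm_self, zero_add,
    sum_boundary, rowTerms, sum_flatMap]
  congr 1
  refine congrArg List.sum (List.map_congr_left fun pi hpi => ?_)
  obtain ⟨-, hout⟩ := mem_bdry hpi
  simp only [rowOK, List.all_eq_true, Bool.and_eq_true, decide_eq_true_eq] at hok
  obtain ⟨hok1, hnd⟩ := hok pi hpi
  rw [toSite_add_dirZ2, midEdgeParafermionicObservable_mk, halfEdgeTerm_out hG hr hout, add_zero,
    halfEdgeTerm_eq_pathSum hG hr hout hfuel (fun l hl => hok1 l hl) hnd, List.map_map,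
    ← List.sum_map_mul_left]
  rfl

/-- **Instantiating an exact boundary relation on `Ω_E`.** [folklore] -/
private theorem inst (hG : GoodEdgeList E) {r w₁ : ZZ} {i₀ : Fin 4} (hr : r ∈ verts E)
    (hnb : nbrs E r = [w₁]) (hdir : w₁ + dirZZ i₀ = r) {fuel : ℕ} (hfuel : (verts E).length ≤ fuel)
    (hok : rowOK E fuel r = true) {x σ : ℝ} {d : Fin 4 → ℂ} (h : ExactBoundaryRelationZ2 x σ d) :
    d i₀ * x + ((rowTerms E fuel r).map fun inm =>
        d inm.1 * ((x : ℂ) ^ inm.2.1 * tpow (tOf σ) inm.2.2)).sum = 0 := by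
  rw [← boundaryFunctional_eq hG i₀ hr hnb hfuel hok x σ d]
  have hadj : (discreteDomainGraph (Omega E) 1).Adj (toSite w₁) (toSite r) :=
    hG.A w₁ r (mem_nbrs_iff.1 (by rw [hnb]; simp)).symm
  exact h (Omega E) 1 (vertsFinset E) (toSite r) (toSite w₁) i₀ one_pos (mem_vertsFinset_iff hG)
    hadj (by rw [toSite_add_dirZ2, hdir]) (leaf_of_nbrs hG hnb)

/-! ### Private copies of the parent module's strip lemmas -/

/-- `e^{-i·0·π/2} = 1`. [folklore] -/
private theorem tOf_zero : tOf 0 = 1 := by simp [tOf]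

/-- At spin `0` every phase is `1`. [folklore] -/
private theorem tpow_tOf_zero (m : ℤ) : tpow (tOf 0) m = 1 := by
  rw [tOf_zero]; unfold tpow; split_ifs <;> simp

/-- Membership in `boxCells`. [folklore] -/
private theorem mem_boxCells_iff {W H : ℕ} {p : ZZ} :
    p ∈ boxCells W H ↔ 0 ≤ p.1 ∧ p.1 < W ∧ 0 ≤ p.2 ∧ p.2 < H := by
  obtain ⟨p1, p2⟩ := p
  constructor
  · intro h
    obtain ⟨a, ha, h⟩ := List.mem_flatMap.1 h
    obtain ⟨b, hb, h⟩ := List.mem_map.1 h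
    rw [List.mem_range] at ha hb
    simp only [Prod.mk.injEq] at h
    obtain ⟨rfl, rfl⟩ := h
    simp only
    omega
  · rintro ⟨h1, h2, h3, h4⟩
    refine List.mem_flatMap.2 ⟨p1.toNat, List.mem_range.2 (by omega),
      List.mem_map.2 ⟨p2.toNat, List.mem_range.2 (by omega), ?_⟩⟩
    simp only [Prod.mk.injEq]
    omega

/-- The vertex hypothesis of `ExactStripRelationZ2` for `Ω_E`, from kernel-checkable list facts. [folklore] -/
private theorem strip_hV {W H j : ℕ} (h1 : ∀ p ∈ verts E, p ∈ boxCells W H ∨ p = (-1, (j : ℤ)))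
    (h2 : ∀ p ∈ boxCells W H, p ∈ verts E) (h3 : ((-1 : ℤ), (j : ℤ)) ∈ verts E) :
    ∀ z, z ∈ vertsFinset E ↔ (0 ≤ z 0 ∧ z 0 < W ∧ 0 ≤ z 1 ∧ z 1 < H) ∨ z = toSite (-1, (j : ℤ)) := by
  intro z
  have hbox : (0 ≤ z 0 ∧ z 0 < W ∧ 0 ≤ z 1 ∧ z 1 < H) ↔ ofSite z ∈ boxCells W H := by
    rw [mem_boxCells_iff]; rfl
  rw [mem_vertsFinset_iff', hbox]
  constructor
  · intro h
    rcases h1 _ h with h' | h'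
    · exact Or.inl h'
    · exact Or.inr (by rw [← toSite_ofSite z, h'])
  · rintro (h | h)
    · exact h2 _ h
    · rw [h, ofSite_toSite]; exact h3

/-- The adjacency hypothesis of `ExactStripRelationZ2` for `Ω_E`, from kernel-checkable list facts. [folklore] -/
private theorem strip_hA (hG : GoodEdgeList E)
    (h4 : ∀ e ∈ E, IsUnitStep (dirOf e.1 e.2) ∧ IsUnitStep (dirOf e.2 e.1))
    (h5 : ∀ p ∈ verts E, ∀ q ∈ verts E, IsUnitStep (dirOf p q) → EAdj E p q) :
    ∀ z z', (discreteDomainGraph (Omega E) 1).Adj z z' ↔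
      z ∈ vertsFinset E ∧ z' ∈ vertsFinset E ∧ IsUnitStep (dirOf (ofSite z) (ofSite z')) := by
  intro z z'
  rw [hG.adj_iff, mem_vertsFinset_iff', mem_vertsFinset_iff']
  constructor
  · intro h
    refine ⟨h.fst_mem_verts, h.snd_mem_verts, ?_⟩
    rcases h with h | h
    · exact (h4 _ h).1
    · exact (h4 _ h).2
  · rintro ⟨hz, hz', hu⟩
    exact h5 _ hz _ hz' hu

/-- The strip functional is the boundary functional at spin `0` with the root coefficient freed. [folklore] -/
private theorem stripFunctional_eq_boundary (Ω : Set ℂ) (δ : ℝ) (V : Finset (Site 2)) (a w₁ : Site 2)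
    (i₀ : Fin 4) (x : ℝ) (c₀ : ℂ) (c : Fin 4 → ℂ) :
    stripFunctionalZ2 Ω δ V a w₁ x c₀ c =
      boundaryFunctionalZ2 Ω δ V a w₁ i₀ x 0 c + (c₀ - c i₀) * midEdgeParafermionicObservable Ω δ a x 0 s(w₁, a) := by
  unfold stripFunctionalZ2 boundaryFunctionalZ2; ring

/-- **Instantiating a fixed-width strip relation on `Ω_E`.** [folklore] -/
private theorem strip_instW (hG : GoodEdgeList E) {W H j : ℕ} (hj : j < H)
    (h1 : ∀ p ∈ verts E, p ∈ boxCells W H ∨ p = (-1, (j : ℤ)))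
    (h2 : ∀ p ∈ boxCells W H, p ∈ verts E) (h3 : ((-1 : ℤ), (j : ℤ)) ∈ verts E)
    (h4 : ∀ e ∈ E, IsUnitStep (dirOf e.1 e.2) ∧ IsUnitStep (dirOf e.2 e.1))
    (h5 : ∀ p ∈ verts E, ∀ q ∈ verts E, IsUnitStep (dirOf p q) → EAdj E p q)
    (hnb : nbrs E (-1, (j : ℤ)) = [(0, (j : ℤ))]) {fuel : ℕ} (hfuel : (verts E).length ≤ fuel)
    (hok : rowOK E fuel (-1, (j : ℤ)) = true) {x : ℝ} {c₀ : ℂ} {c : Fin 4 → ℂ}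
    (h : ExactStripRelationZ2W W x c₀ c) :
    c₀ * x + ((rowTerms E fuel (-1, (j : ℤ))).map fun inm =>
        c inm.1 * ((x : ℂ) ^ inm.2.1 * tpow (tOf 0) inm.2.2)).sum = 0 := by
  have hadj : (discreteDomainGraph (Omega E) 1).Adj (toSite (0, (j : ℤ))) (toSite (-1, (j : ℤ))) :=
    hG.A _ _ (mem_nbrs_iff.1 (by rw [hnb]; simp)).symm
  have key := h (Omega E) 1 (vertsFinset E) H j one_pos hj (mem_vertsFinset_iff hG)
    (strip_hV h1 h2 h3) (strip_hA hG h4 h5)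
  rw [stripFunctional_eq_boundary _ _ _ _ _ 2, boundaryFunctional_eq hG 2 h3 hnb hfuel hok x 0 c,
    midEdgeParafermionicObservable_mk, halfEdgeTerm_leaf hadj (leaf_of_nbrs hG hnb), halfEdgeTerm_self,
    zero_add] at key
  linear_combination key

/-! ### The seven width-2 instances -/

/-- Kernel certificate: unit darts, connected. [folklore] -/
private theorem goodWS210 : GoodEdgeList ES210 := ⟨by decide, ⟨(-1, 0), by decide, 4, by decide⟩⟩

/-- The boundary monomials of the strip instance `S210` (kernel evaluation of `rowTerms`). [folklore] -/
private theorem rowWS210 : rowTerms ES210 4 (-1, 0) =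
  [(0, 3, Int.ofNat 0), (1, 3, Int.ofNat 1), (3, 3, Int.negSucc 0), (1, 2, Int.ofNat 1), (3, 2, Int.negSucc 0)] := by
  decide

/-- The width-2 strip relation instantiated on `S210`. [folklore] -/
private theorem instWS210 {x : ℝ} {c₀ : ℂ} {c : Fin 4 → ℂ} (h : ExactStripRelationZ2W 2 x c₀ c) :
    c₀ * (x : ℂ) + c 0 * ((x : ℂ) ^ (3 : ℕ)) + c 1 * ((x : ℂ) ^ (2 : ℕ) + (x : ℂ) ^ (3 : ℕ)) + c 3 * ((x : ℂ) ^ (2 : ℕ) + (x : ℂ) ^ (3 : ℕ)) = 0 := by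
  have h0 := strip_instW goodWS210 (W := 2) (H := 1) (j := 0) (by decide) (by decide) (by decide) (by decide)
    (by decide) (by decide) (by decide) (fuel := 4) (by decide) (by decide) h
  simp only [Nat.cast_zero] at h0
  rw [rowWS210] at h0
  simp only [List.map_cons, List.map_nil, List.sum_cons, List.sum_nil, add_zero, tpow_tOf_zero, mul_one] at h0
  linear_combination h0

/-- Kernel certificate: unit darts, connected. [folklore] -/
private theorem goodWS220 : GoodEdgeList ES220 := ⟨by decide, ⟨(-1, 0), by decide, 10, by decide⟩⟩

/-- The boundary monomials of the strip instance `S220` (kernel evaluation of `rowTerms`). [folklore] -/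
private theorem rowWS220 : rowTerms ES220 10 (-1, 0) =
  [(1, 5, Int.ofNat 1), (1, 3, Int.ofNat 1), (2, 5, Int.ofNat 2), (2, 3, Int.ofNat 2), (0, 3, Int.ofNat 0), (0, 5, Int.ofNat 0), (3, 3, Int.negSucc 0),
      (3, 5, Int.negSucc 0), (0, 4, Int.ofNat 0), (0, 4, Int.ofNat 0), (1, 4, Int.ofNat 1), (1, 4, Int.ofNat 1), (3, 2, Int.negSucc 0)] := by
  decide

/-- The width-2 strip relation instantiated on `S220`. [folklore] -/
private theorem instWS220 {x : ℝ} {c₀ : ℂ} {c : Fin 4 → ℂ} (h : ExactStripRelationZ2W 2 x c₀ c) :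
    c₀ * (x : ℂ) + c 0 * ((x : ℂ) ^ (3 : ℕ) + (2 : ℂ) * (x : ℂ) ^ (4 : ℕ) + (x : ℂ) ^ (5 : ℕ)) + c 1 * ((x : ℂ) ^ (3 : ℕ) +
        (2 : ℂ) * (x : ℂ) ^ (4 : ℕ) + (x : ℂ) ^ (5 : ℕ)) + c 2 * ((x : ℂ) ^ (3 : ℕ) + (x : ℂ) ^ (5 : ℕ)) + c 3 * ((x : ℂ) ^ (2 : ℕ) +
        (x : ℂ) ^ (3 : ℕ) + (x : ℂ) ^ (5 : ℕ)) = 0 := by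
  have h0 := strip_instW goodWS220 (W := 2) (H := 2) (j := 0) (by decide) (by decide) (by decide) (by decide)
    (by decide) (by decide) (by decide) (fuel := 10) (by decide) (by decide) h
  simp only [Nat.cast_zero] at h0
  rw [rowWS220] at h0
  simp only [List.map_cons, List.map_nil, List.sum_cons, List.sum_nil, add_zero, tpow_tOf_zero, mul_one] at h0
  linear_combination h0

/-- Kernel certificate: unit darts, connected. [folklore] -/
private theorem goodWS221 : GoodEdgeList ES221 := ⟨by decide, ⟨(-1, 1), by decide, 10, by decide⟩⟩

/-- The boundary monomials of the strip instance `S221` (kernel evaluation of `rowTerms`). [folklore] -/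
private theorem rowWS221 : rowTerms ES221 10 (-1, 1) =
  [(2, 5, Int.negSucc 1), (2, 3, Int.negSucc 1), (3, 5, Int.negSucc 0), (3, 3, Int.negSucc 0), (0, 4, Int.ofNat 0), (0, 4, Int.ofNat 0), (3, 4,
      Int.negSucc 0), (3, 4, Int.negSucc 0), (0, 3, Int.ofNat 0), (0, 5, Int.ofNat 0), (1, 3, Int.ofNat 1), (1, 5, Int.ofNat 1), (1, 2,
      Int.ofNat 1)] := by
  decide

/-- The width-2 strip relation instantiated on `S221`. [folklore] -/
private theorem instWS221 {x : ℝ} {c₀ : ℂ} {c : Fin 4 → ℂ} (h : ExactStripRelationZ2W 2 x c₀ c) :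
    c₀ * (x : ℂ) + c 0 * ((x : ℂ) ^ (3 : ℕ) + (2 : ℂ) * (x : ℂ) ^ (4 : ℕ) + (x : ℂ) ^ (5 : ℕ)) + c 1 * ((x : ℂ) ^ (2 : ℕ) + (x : ℂ) ^ (3 : ℕ) +
        (x : ℂ) ^ (5 : ℕ)) + c 2 * ((x : ℂ) ^ (3 : ℕ) + (x : ℂ) ^ (5 : ℕ)) + c 3 * ((x : ℂ) ^ (3 : ℕ) + (2 : ℂ) * (x : ℂ) ^ (4 : ℕ) +
        (x : ℂ) ^ (5 : ℕ)) = 0 := by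
  have h0 := strip_instW goodWS221 (W := 2) (H := 2) (j := 1) (by decide) (by decide) (by decide) (by decide)
    (by decide) (by decide) (by decide) (fuel := 10) (by decide) (by decide) h
  simp only [Nat.cast_one] at h0
  rw [rowWS221] at h0
  simp only [List.map_cons, List.map_nil, List.sum_cons, List.sum_nil, add_zero, tpow_tOf_zero, mul_one] at h0
  linear_combination h0

/-- Edge list of the strip instance `S230`: the `2 × 3` rectangle with west pendant root `(-1, 0)`. [folklore] -/
def ES230 : List (ZZ × ZZ) :=
  [((0, 0), (1, 0)), ((0, 0), (0, 1)), ((0, 1), (1, 1)), ((0, 1), (0, 2)), ((0, 2), (1, 2)), ((1, 0), (1, 1)), ((1, 1), (1, 2)), ((-1, 0), (0, 0))]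

/-- Kernel certificate: unit darts, connected. [folklore] -/
private theorem goodWS230 : GoodEdgeList ES230 := ⟨by decide, ⟨(-1, 0), by decide, 16, by decide⟩⟩

/-- The boundary monomials of the strip instance `S230` (kernel evaluation of `rowTerms`). [folklore] -/
private theorem rowWS230 : rowTerms ES230 16 (-1, 0) =
  [(2, 7, Int.ofNat 2), (2, 5, Int.ofNat 2), (2, 3, Int.ofNat 2), (1, 6, Int.ofNat 1), (1, 6, Int.ofNat 1), (1, 6, Int.ofNat 1), (1, 4, Int.ofNat 1),
      (2, 6, Int.ofNat 2), (2, 6, Int.ofNat 2), (2, 6, Int.ofNat 2), (2, 4, Int.ofNat 2), (0, 3, Int.ofNat 0), (0, 5, Int.ofNat 0), (0, 7,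
      Int.ofNat 0), (3, 3, Int.negSucc 0), (3, 5, Int.negSucc 0), (3, 7, Int.negSucc 0), (0, 4, Int.ofNat 0), (0, 4, Int.ofNat 0), (0, 6, Int.ofNat 0),
      (0, 5, Int.ofNat 0), (0, 7, Int.ofNat 0), (0, 5, Int.ofNat 0), (0, 5, Int.ofNat 0), (1, 5, Int.ofNat 1), (1, 7, Int.ofNat 1), (1, 5,
      Int.ofNat 1), (1, 5, Int.ofNat 1), (3, 2, Int.negSucc 0)] := by
  decide

/-- The width-2 strip relation instantiated on `S230`. [folklore] -/
private theorem instWS230 {x : ℝ} {c₀ : ℂ} {c : Fin 4 → ℂ} (h : ExactStripRelationZ2W 2 x c₀ c) :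
    c₀ * (x : ℂ) + c 0 * ((x : ℂ) ^ (3 : ℕ) + (2 : ℂ) * (x : ℂ) ^ (4 : ℕ) + (4 : ℂ) * (x : ℂ) ^ (5 : ℕ) + (x : ℂ) ^ (6 : ℕ) +
        (2 : ℂ) * (x : ℂ) ^ (7 : ℕ)) + c 1 * ((x : ℂ) ^ (4 : ℕ) + (3 : ℂ) * (x : ℂ) ^ (5 : ℕ) + (3 : ℂ) * (x : ℂ) ^ (6 : ℕ) + (x : ℂ) ^ (7 : ℕ)) +
        c 2 * ((x : ℂ) ^ (3 : ℕ) + (x : ℂ) ^ (4 : ℕ) + (x : ℂ) ^ (5 : ℕ) + (3 : ℂ) * (x : ℂ) ^ (6 : ℕ) + (x : ℂ) ^ (7 : ℕ)) + c 3 * ((x : ℂ) ^ (2 : ℕ) +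
        (x : ℂ) ^ (3 : ℕ) + (x : ℂ) ^ (5 : ℕ) + (x : ℂ) ^ (7 : ℕ)) = 0 := by
  have h0 := strip_instW goodWS230 (W := 2) (H := 3) (j := 0) (by decide) (by decide) (by decide) (by decide)
    (by decide) (by decide) (by decide) (fuel := 16) (by decide) (by decide) h
  simp only [Nat.cast_zero] at h0
  rw [rowWS230] at h0
  simp only [List.map_cons, List.map_nil, List.sum_cons, List.sum_nil, add_zero, tpow_tOf_zero, mul_one] at h0
  linear_combination h0

/-- Kernel certificate: unit darts, connected. [folklore] -/
private theorem goodWS231 : GoodEdgeList ES231 := ⟨by decide, ⟨(-1, 1), by decide, 16, by decide⟩⟩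

/-- The boundary monomials of the strip instance `S231` (kernel evaluation of `rowTerms`). [folklore] -/
private theorem rowWS231 : rowTerms ES231 16 (-1, 1) =
  [(2, 5, Int.negSucc 1), (2, 7, Int.negSucc 1), (2, 3, Int.negSucc 1), (3, 5, Int.negSucc 0), (3, 7, Int.negSucc 0), (3, 3, Int.negSucc 0), (1, 5,
      Int.ofNat 1), (1, 3, Int.ofNat 1), (1, 7, Int.ofNat 1), (2, 5, Int.ofNat 2), (2, 3, Int.ofNat 2), (2, 7, Int.ofNat 2), (0, 4, Int.ofNat 0), (0,
      6, Int.ofNat 0), (0, 4, Int.ofNat 0), (3, 4, Int.negSucc 0), (3, 6, Int.negSucc 0), (3, 4, Int.negSucc 0), (0, 3, Int.ofNat 0), (0, 5,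
      Int.ofNat 0), (0, 5, Int.ofNat 0), (0, 4, Int.ofNat 0), (0, 4, Int.ofNat 0), (0, 6, Int.ofNat 0), (1, 4, Int.ofNat 1), (1, 4, Int.ofNat 1), (1,
      6, Int.ofNat 1)] := by
  decide

/-- The width-2 strip relation instantiated on `S231`. [folklore] -/
private theorem instWS231 {x : ℝ} {c₀ : ℂ} {c : Fin 4 → ℂ} (h : ExactStripRelationZ2W 2 x c₀ c) :
    c₀ * (x : ℂ) + c 0 * ((x : ℂ) ^ (3 : ℕ) + (4 : ℂ) * (x : ℂ) ^ (4 : ℕ) + (2 : ℂ) * (x : ℂ) ^ (5 : ℕ) + (2 : ℂ) * (x : ℂ) ^ (6 : ℕ)) +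
        c 1 * ((x : ℂ) ^ (3 : ℕ) + (2 : ℂ) * (x : ℂ) ^ (4 : ℕ) + (x : ℂ) ^ (5 : ℕ) + (x : ℂ) ^ (6 : ℕ) + (x : ℂ) ^ (7 : ℕ)) +
        c 2 * ((2 : ℂ) * (x : ℂ) ^ (3 : ℕ) + (2 : ℂ) * (x : ℂ) ^ (5 : ℕ) + (2 : ℂ) * (x : ℂ) ^ (7 : ℕ)) + c 3 * ((x : ℂ) ^ (3 : ℕ) +
        (2 : ℂ) * (x : ℂ) ^ (4 : ℕ) + (x : ℂ) ^ (5 : ℕ) + (x : ℂ) ^ (6 : ℕ) + (x : ℂ) ^ (7 : ℕ)) = 0 := by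
  have h0 := strip_instW goodWS231 (W := 2) (H := 3) (j := 1) (by decide) (by decide) (by decide) (by decide)
    (by decide) (by decide) (by decide) (fuel := 16) (by decide) (by decide) h
  simp only [Nat.cast_one] at h0
  rw [rowWS231] at h0
  simp only [List.map_cons, List.map_nil, List.sum_cons, List.sum_nil, add_zero, tpow_tOf_zero, mul_one] at h0
  linear_combination h0

/-- Edge list of the strip instance `S232`: the `2 × 3` rectangle with west pendant root `(-1, 2)`. [folklore] -/
def ES232 : List (ZZ × ZZ) :=
  [((0, 0), (1, 0)), ((0, 0), (0, 1)), ((0, 1), (1, 1)), ((0, 1), (0, 2)), ((0, 2), (1, 2)), ((1, 0), (1, 1)), ((1, 1), (1, 2)), ((-1, 2), (0, 2))]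

/-- Kernel certificate: unit darts, connected. [folklore] -/
private theorem goodWS232 : GoodEdgeList ES232 := ⟨by decide, ⟨(-1, 2), by decide, 16, by decide⟩⟩

/-- The boundary monomials of the strip instance `S232` (kernel evaluation of `rowTerms`). [folklore] -/
private theorem rowWS232 : rowTerms ES232 16 (-1, 2) =
  [(2, 6, Int.negSucc 1), (2, 6, Int.negSucc 1), (2, 6, Int.negSucc 1), (2, 4, Int.negSucc 1), (3, 6, Int.negSucc 0), (3, 6, Int.negSucc 0), (3, 6,
      Int.negSucc 0), (3, 4, Int.negSucc 0), (2, 5, Int.negSucc 1), (2, 7, Int.negSucc 1), (2, 3, Int.negSucc 1), (0, 7, Int.ofNat 0), (0, 5,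
      Int.ofNat 0), (0, 5, Int.ofNat 0), (0, 5, Int.ofNat 0), (3, 7, Int.negSucc 0), (3, 5, Int.negSucc 0), (3, 5, Int.negSucc 0), (3, 5,
      Int.negSucc 0), (0, 4, Int.ofNat 0), (0, 4, Int.ofNat 0), (0, 6, Int.ofNat 0), (0, 3, Int.ofNat 0), (0, 5, Int.ofNat 0), (0, 7, Int.ofNat 0), (1,
      3, Int.ofNat 1), (1, 5, Int.ofNat 1), (1, 7, Int.ofNat 1), (1, 2, Int.ofNat 1)] := by
  decide

/-- The width-2 strip relation instantiated on `S232`. [folklore] -/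
private theorem instWS232 {x : ℝ} {c₀ : ℂ} {c : Fin 4 → ℂ} (h : ExactStripRelationZ2W 2 x c₀ c) :
    c₀ * (x : ℂ) + c 0 * ((x : ℂ) ^ (3 : ℕ) + (2 : ℂ) * (x : ℂ) ^ (4 : ℕ) + (4 : ℂ) * (x : ℂ) ^ (5 : ℕ) + (x : ℂ) ^ (6 : ℕ) +
        (2 : ℂ) * (x : ℂ) ^ (7 : ℕ)) + c 1 * ((x : ℂ) ^ (2 : ℕ) + (x : ℂ) ^ (3 : ℕ) + (x : ℂ) ^ (5 : ℕ) + (x : ℂ) ^ (7 : ℕ)) +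
        c 2 * ((x : ℂ) ^ (3 : ℕ) + (x : ℂ) ^ (4 : ℕ) + (x : ℂ) ^ (5 : ℕ) + (3 : ℂ) * (x : ℂ) ^ (6 : ℕ) + (x : ℂ) ^ (7 : ℕ)) + c 3 * ((x : ℂ) ^ (4 : ℕ) +
        (3 : ℂ) * (x : ℂ) ^ (5 : ℕ) + (3 : ℂ) * (x : ℂ) ^ (6 : ℕ) + (x : ℂ) ^ (7 : ℕ)) = 0 := by
  have h0 := strip_instW goodWS232 (W := 2) (H := 3) (j := 2) (by decide) (by decide) (by decide) (by decide)
    (by decide) (by decide) (by decide) (fuel := 16) (by decide) (by decide) h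
  simp only [Nat.cast_ofNat] at h0
  rw [rowWS232] at h0
  simp only [List.map_cons, List.map_nil, List.sum_cons, List.sum_nil, add_zero, tpow_tOf_zero, mul_one] at h0
  linear_combination h0

/-- Edge list of the strip instance `S240`: the `2 × 4` rectangle with west pendant root `(-1, 0)`. [folklore] -/
def ES240 : List (ZZ × ZZ) :=
  [((0, 0), (1, 0)), ((0, 0), (0, 1)), ((0, 1), (1, 1)), ((0, 1), (0, 2)), ((0, 2), (1, 2)), ((0, 2), (0, 3)), ((0, 3), (1, 3)), ((1, 0), (1, 1)), ((1,
      1), (1, 2)), ((1, 2), (1, 3)), ((-1, 0), (0, 0))]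

/-- Kernel certificate: unit darts, connected. [folklore] -/
private theorem goodWS240 : GoodEdgeList ES240 := ⟨by decide, ⟨(-1, 0), by decide, 22, by decide⟩⟩

/-- The boundary monomials of the strip instance `S240` (kernel evaluation of `rowTerms`). [folklore] -/
private theorem rowWS240 : rowTerms ES240 22 (-1, 0) =
  [(2, 9, Int.ofNat 2), (2, 7, Int.ofNat 2), (2, 5, Int.ofNat 2), (2, 3, Int.ofNat 2), (2, 8, Int.ofNat 2), (2, 6, Int.ofNat 2), (2, 6, Int.ofNat 2),
      (2, 8, Int.ofNat 2), (2, 6, Int.ofNat 2), (2, 4, Int.ofNat 2), (1, 7, Int.ofNat 1), (1, 7, Int.ofNat 1), (1, 9, Int.ofNat 1), (1, 7,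
      Int.ofNat 1), (1, 7, Int.ofNat 1), (1, 7, Int.ofNat 1), (1, 7, Int.ofNat 1), (1, 5, Int.ofNat 1), (2, 7, Int.ofNat 2), (2, 7, Int.ofNat 2), (2,
      9, Int.ofNat 2), (2, 7, Int.ofNat 2), (2, 7, Int.ofNat 2), (2, 7, Int.ofNat 2), (2, 7, Int.ofNat 2), (2, 5, Int.ofNat 2), (0, 3, Int.ofNat 0),
      (0, 5, Int.ofNat 0), (0, 7, Int.ofNat 0), (0, 9, Int.ofNat 0), (3, 3, Int.negSucc 0), (3, 5, Int.negSucc 0), (3, 7, Int.negSucc 0), (3, 9,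
      Int.negSucc 0), (0, 4, Int.ofNat 0), (0, 4, Int.ofNat 0), (0, 6, Int.ofNat 0), (0, 8, Int.ofNat 0), (0, 5, Int.ofNat 0), (0, 7, Int.ofNat 0), (0,
      9, Int.ofNat 0), (0, 5, Int.ofNat 0), (0, 5, Int.ofNat 0), (0, 7, Int.ofNat 0), (0, 6, Int.ofNat 0), (0, 8, Int.ofNat 0), (0, 8, Int.ofNat 0),
      (0, 8, Int.ofNat 0), (0, 6, Int.ofNat 0), (0, 8, Int.ofNat 0), (0, 6, Int.ofNat 0), (0, 6, Int.ofNat 0), (1, 6, Int.ofNat 1), (1, 8,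
      Int.ofNat 1), (1, 8, Int.ofNat 1), (1, 8, Int.ofNat 1), (1, 6, Int.ofNat 1), (1, 8, Int.ofNat 1), (1, 6, Int.ofNat 1), (1, 6, Int.ofNat 1), (3,
      2, Int.negSucc 0)] := by
  decide

/-- The width-2 strip relation instantiated on `S240`. [folklore] -/
private theorem instWS240 {x : ℝ} {c₀ : ℂ} {c : Fin 4 → ℂ} (h : ExactStripRelationZ2W 2 x c₀ c) :
    c₀ * (x : ℂ) + c 0 * ((x : ℂ) ^ (3 : ℕ) + (2 : ℂ) * (x : ℂ) ^ (4 : ℕ) + (4 : ℂ) * (x : ℂ) ^ (5 : ℕ) + (5 : ℂ) * (x : ℂ) ^ (6 : ℕ) +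
        (3 : ℂ) * (x : ℂ) ^ (7 : ℕ) + (5 : ℂ) * (x : ℂ) ^ (8 : ℕ) + (2 : ℂ) * (x : ℂ) ^ (9 : ℕ)) + c 1 * ((x : ℂ) ^ (5 : ℕ) +
        (4 : ℂ) * (x : ℂ) ^ (6 : ℕ) + (6 : ℂ) * (x : ℂ) ^ (7 : ℕ) + (4 : ℂ) * (x : ℂ) ^ (8 : ℕ) + (x : ℂ) ^ (9 : ℕ)) + c 2 * ((x : ℂ) ^ (3 : ℕ) +
        (x : ℂ) ^ (4 : ℕ) + (2 : ℂ) * (x : ℂ) ^ (5 : ℕ) + (3 : ℂ) * (x : ℂ) ^ (6 : ℕ) + (7 : ℂ) * (x : ℂ) ^ (7 : ℕ) + (2 : ℂ) * (x : ℂ) ^ (8 : ℕ) +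
        (2 : ℂ) * (x : ℂ) ^ (9 : ℕ)) + c 3 * ((x : ℂ) ^ (2 : ℕ) + (x : ℂ) ^ (3 : ℕ) + (x : ℂ) ^ (5 : ℕ) + (x : ℂ) ^ (7 : ℕ) +
        (x : ℂ) ^ (9 : ℕ)) = 0 := by
  have h0 := strip_instW goodWS240 (W := 2) (H := 4) (j := 0) (by decide) (by decide) (by decide) (by decide)
    (by decide) (by decide) (by decide) (fuel := 22) (by decide) (by decide) h
  simp only [Nat.cast_zero] at h0
  rw [rowWS240] at h0
  simp only [List.map_cons, List.map_nil, List.sum_cons, List.sum_nil, add_zero, tpow_tOf_zero, mul_one] at h0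
  linear_combination h0

/-- **Algebraic core, width `2`.** The seven width-2 relations force all five constants to vanish for
`x ≠ 0` (explicit certificates of degree `≤ 7`). [folklore] -/
private theorem strip_core_w2 {x : ℂ} (hx : x ≠ 0) {c₀ d0 d1 d2 d3 : ℂ}
    (e210 : c₀ * x + d0 * (x ^ (3 : ℕ)) + d1 * (x ^ (2 : ℕ) + x ^ (3 : ℕ)) + d3 * (x ^ (2 : ℕ) + x ^ (3 : ℕ)) = 0)
    (e220 : c₀ * x + d0 * (x ^ (3 : ℕ) + (2 : ℂ) * x ^ (4 : ℕ) + x ^ (5 : ℕ)) + d1 * (x ^ (3 : ℕ) + (2 : ℂ) * x ^ (4 : ℕ) + x ^ (5 : ℕ)) +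
        d2 * (x ^ (3 : ℕ) + x ^ (5 : ℕ)) + d3 * (x ^ (2 : ℕ) + x ^ (3 : ℕ) + x ^ (5 : ℕ)) = 0)
    (e221 : c₀ * x + d0 * (x ^ (3 : ℕ) + (2 : ℂ) * x ^ (4 : ℕ) + x ^ (5 : ℕ)) + d1 * (x ^ (2 : ℕ) + x ^ (3 : ℕ) + x ^ (5 : ℕ)) + d2 * (x ^ (3 : ℕ) +
        x ^ (5 : ℕ)) + d3 * (x ^ (3 : ℕ) + (2 : ℂ) * x ^ (4 : ℕ) + x ^ (5 : ℕ)) = 0)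
    (e230 : c₀ * x + d0 * (x ^ (3 : ℕ) + (2 : ℂ) * x ^ (4 : ℕ) + (4 : ℂ) * x ^ (5 : ℕ) + x ^ (6 : ℕ) + (2 : ℂ) * x ^ (7 : ℕ)) + d1 * (x ^ (4 : ℕ) +
        (3 : ℂ) * x ^ (5 : ℕ) + (3 : ℂ) * x ^ (6 : ℕ) + x ^ (7 : ℕ)) + d2 * (x ^ (3 : ℕ) + x ^ (4 : ℕ) + x ^ (5 : ℕ) + (3 : ℂ) * x ^ (6 : ℕ) +
        x ^ (7 : ℕ)) + d3 * (x ^ (2 : ℕ) + x ^ (3 : ℕ) + x ^ (5 : ℕ) + x ^ (7 : ℕ)) = 0)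
    (e231 : c₀ * x + d0 * (x ^ (3 : ℕ) + (4 : ℂ) * x ^ (4 : ℕ) + (2 : ℂ) * x ^ (5 : ℕ) + (2 : ℂ) * x ^ (6 : ℕ)) + d1 * (x ^ (3 : ℕ) +
        (2 : ℂ) * x ^ (4 : ℕ) + x ^ (5 : ℕ) + x ^ (6 : ℕ) + x ^ (7 : ℕ)) + d2 * ((2 : ℂ) * x ^ (3 : ℕ) + (2 : ℂ) * x ^ (5 : ℕ) +
        (2 : ℂ) * x ^ (7 : ℕ)) + d3 * (x ^ (3 : ℕ) + (2 : ℂ) * x ^ (4 : ℕ) + x ^ (5 : ℕ) + x ^ (6 : ℕ) + x ^ (7 : ℕ)) = 0)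
    (e232 : c₀ * x + d0 * (x ^ (3 : ℕ) + (2 : ℂ) * x ^ (4 : ℕ) + (4 : ℂ) * x ^ (5 : ℕ) + x ^ (6 : ℕ) + (2 : ℂ) * x ^ (7 : ℕ)) + d1 * (x ^ (2 : ℕ) +
        x ^ (3 : ℕ) + x ^ (5 : ℕ) + x ^ (7 : ℕ)) + d2 * (x ^ (3 : ℕ) + x ^ (4 : ℕ) + x ^ (5 : ℕ) + (3 : ℂ) * x ^ (6 : ℕ) + x ^ (7 : ℕ)) +
        d3 * (x ^ (4 : ℕ) + (3 : ℂ) * x ^ (5 : ℕ) + (3 : ℂ) * x ^ (6 : ℕ) + x ^ (7 : ℕ)) = 0)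
    (e240 : c₀ * x + d0 * (x ^ (3 : ℕ) + (2 : ℂ) * x ^ (4 : ℕ) + (4 : ℂ) * x ^ (5 : ℕ) + (5 : ℂ) * x ^ (6 : ℕ) + (3 : ℂ) * x ^ (7 : ℕ) +
        (5 : ℂ) * x ^ (8 : ℕ) + (2 : ℂ) * x ^ (9 : ℕ)) + d1 * (x ^ (5 : ℕ) + (4 : ℂ) * x ^ (6 : ℕ) + (6 : ℂ) * x ^ (7 : ℕ) + (4 : ℂ) * x ^ (8 : ℕ) +
        x ^ (9 : ℕ)) + d2 * (x ^ (3 : ℕ) + x ^ (4 : ℕ) + (2 : ℂ) * x ^ (5 : ℕ) + (3 : ℂ) * x ^ (6 : ℕ) + (7 : ℂ) * x ^ (7 : ℕ) + (2 : ℂ) * x ^ (8 : ℕ) +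
        (2 : ℂ) * x ^ (9 : ℕ)) + d3 * (x ^ (2 : ℕ) + x ^ (3 : ℕ) + x ^ (5 : ℕ) + x ^ (7 : ℕ) + x ^ (9 : ℕ)) = 0)
    : c₀ = 0 ∧ d0 = 0 ∧ d1 = 0 ∧ d2 = 0 ∧ d3 = 0 := by
  have hx8 : x ^ (8 : ℕ) ≠ 0 := pow_ne_zero 8 hx
  refine ⟨?_, ?_, ?_, ?_, ?_⟩
  · have h : x ^ (8 : ℕ) * c₀ = 0 := by
      linear_combination (((-4 : ℂ) / 5) * x + ((-4 : ℂ) / 5) * x ^ (2 : ℕ) + ((8 : ℂ) / 5) * x ^ (3 : ℕ) + (3 : ℂ) * x ^ (4 : ℕ) +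
          (3 : ℂ) * x ^ (5 : ℕ) + ((17 : ℂ) / 10) * x ^ (6 : ℕ) + ((8 : ℂ) / 5) * x ^ (7 : ℕ)) * e210 + (((3 : ℂ) / 8) + ((3 : ℂ) / 20) * x +
          ((-57 : ℂ) / 20) * x ^ (2 : ℕ) + ((-241 : ℂ) / 40) * x ^ (3 : ℕ) + ((-283 : ℂ) / 40) * x ^ (4 : ℕ) + ((-167 : ℂ) / 40) * x ^ (5 : ℕ) +
          ((-33 : ℂ) / 20) * x ^ (6 : ℕ) + ((-9 : ℂ) / 20) * x ^ (7 : ℕ)) * e220 + (((-3 : ℂ) / 8) + ((-3 : ℂ) / 20) * x +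
          ((13 : ℂ) / 20) * x ^ (2 : ℕ) + ((37 : ℂ) / 40) * x ^ (3 : ℕ) + ((43 : ℂ) / 40) * x ^ (4 : ℕ) + ((11 : ℂ) / 40) * x ^ (5 : ℕ) +
          ((-1 : ℂ) / 20) * x ^ (6 : ℕ) + ((-3 : ℂ) / 20) * x ^ (7 : ℕ)) * e221 + (((17 : ℂ) / 40) + ((101 : ℂ) / 40) * x +
          ((59 : ℂ) / 10) * x ^ (2 : ℕ) + ((53 : ℂ) / 10) * x ^ (3 : ℕ) + ((29 : ℂ) / 10) * x ^ (4 : ℕ) + ((3 : ℂ) / 5) * x ^ (5 : ℕ)) * e230 +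
          (((-4 : ℂ) / 5) * x + ((-8 : ℂ) / 5) * x ^ (2 : ℕ) + ((-3 : ℂ) / 2) * x ^ (3 : ℕ) + ((1 : ℂ) / 10) * x ^ (4 : ℕ) +
          ((3 : ℂ) / 10) * x ^ (5 : ℕ)) * e231 + (((3 : ℂ) / 8) + ((23 : ℂ) / 40) * x) * e232 + (((-4 : ℂ) / 5) + ((-3 : ℂ) / 2) * x +
          ((-13 : ℂ) / 10) * x ^ (2 : ℕ) + ((-3 : ℂ) / 10) * x ^ (3 : ℕ)) * e240
    exact (mul_eq_zero.1 h).resolve_left hx8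
  · have h : x ^ (8 : ℕ) * d0 = 0 := by
      linear_combination (((-1 : ℂ) / 2) + ((33 : ℂ) / 10) * x + ((-17 : ℂ) / 10) * x ^ (2 : ℕ) + ((-43 : ℂ) / 5) * x ^ (3 : ℕ) +
          (9 : ℂ) * x ^ (4 : ℕ) + ((1 : ℂ) / 2) * x ^ (5 : ℕ) + ((33 : ℂ) / 10) * x ^ (6 : ℕ) + ((17 : ℂ) / 5) * x ^ (7 : ℕ)) * e210 + ((2 : ℂ) +
          ((149 : ℂ) / 40) * x + ((-11 : ℂ) / 40) * x ^ (2 : ℕ) + ((-179 : ℂ) / 40) * x ^ (3 : ℕ) + ((-84 : ℂ) / 5) * x ^ (4 : ℕ) +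
          ((-293 : ℂ) / 40) * x ^ (5 : ℕ) + ((-23 : ℂ) / 5) * x ^ (6 : ℕ) + ((-51 : ℂ) / 20) * x ^ (7 : ℕ)) * e220 + ((-1 : ℂ) + ((-109 : ℂ) / 40) * x +
          ((-41 : ℂ) / 40) * x ^ (2 : ℕ) + ((343 : ℂ) / 40) * x ^ (3 : ℕ) + ((3 : ℂ) / 10) * x ^ (4 : ℕ) + ((69 : ℂ) / 40) * x ^ (5 : ℕ) +
          ((13 : ℂ) / 10) * x ^ (6 : ℕ) + ((-17 : ℂ) / 20) * x ^ (7 : ℕ)) * e221 + (((-29 : ℂ) / 5) + ((-61 : ℂ) / 40) * x +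
          ((28 : ℂ) / 5) * x ^ (2 : ℕ) + ((61 : ℂ) / 5) * x ^ (3 : ℕ) + ((101 : ℂ) / 10) * x ^ (4 : ℕ) + ((17 : ℂ) / 5) * x ^ (5 : ℕ)) * e230 +
          (((-1 : ℂ) / 2) + ((33 : ℂ) / 10) * x + ((8 : ℂ) / 5) * x ^ (2 : ℕ) + (-6 : ℂ) * x ^ (3 : ℕ) + ((-13 : ℂ) / 5) * x ^ (4 : ℕ) +
          ((17 : ℂ) / 10) * x ^ (5 : ℕ)) * e231 + (((3 : ℂ) / 2) + ((-83 : ℂ) / 40) * x) * e232 + (((43 : ℂ) / 10) + (-4 : ℂ) * x +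
          ((-21 : ℂ) / 5) * x ^ (2 : ℕ) + ((-17 : ℂ) / 10) * x ^ (3 : ℕ)) * e240
    exact (mul_eq_zero.1 h).resolve_left hx8
  · have h : x ^ (8 : ℕ) * d1 = 0 := by
      linear_combination (((9 : ℂ) / 10) * x + ((-1 : ℂ) / 10) * x ^ (2 : ℕ) + ((-14 : ℂ) / 5) * x ^ (3 : ℕ) + -(x ^ (5 : ℕ)) +
          ((-1 : ℂ) / 10) * x ^ (6 : ℕ) + ((1 : ℂ) / 5) * x ^ (7 : ℕ)) * e210 + (((-1 : ℂ) / 8) + ((21 : ℂ) / 20) * x + ((41 : ℂ) / 20) * x ^ (2 : ℕ) +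
          ((123 : ℂ) / 40) * x ^ (3 : ℕ) + ((29 : ℂ) / 40) * x ^ (4 : ℕ) + ((21 : ℂ) / 40) * x ^ (5 : ℕ) + ((-1 : ℂ) / 20) * x ^ (6 : ℕ) +
          ((-3 : ℂ) / 20) * x ^ (7 : ℕ)) * e220 + (((1 : ℂ) / 8) + ((-1 : ℂ) / 20) * x + ((-9 : ℂ) / 20) * x ^ (2 : ℕ) + ((49 : ℂ) / 40) * x ^ (3 : ℕ) +
          ((-29 : ℂ) / 40) * x ^ (4 : ℕ) + ((7 : ℂ) / 40) * x ^ (5 : ℕ) + ((3 : ℂ) / 20) * x ^ (6 : ℕ) + ((-1 : ℂ) / 20) * x ^ (7 : ℕ)) * e221 +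
          (((-51 : ℂ) / 40) + ((-103 : ℂ) / 40) * x + ((-27 : ℂ) / 10) * x ^ (2 : ℕ) + ((-9 : ℂ) / 10) * x ^ (3 : ℕ) + ((3 : ℂ) / 10) * x ^ (4 : ℕ) +
          ((1 : ℂ) / 5) * x ^ (5 : ℕ)) * e230 + (((9 : ℂ) / 10) * x + ((13 : ℂ) / 10) * x ^ (2 : ℕ) + ((-1 : ℂ) / 2) * x ^ (3 : ℕ) +
          ((-3 : ℂ) / 10) * x ^ (4 : ℕ) + ((1 : ℂ) / 10) * x ^ (5 : ℕ)) * e231 + (((-1 : ℂ) / 8) + ((-29 : ℂ) / 40) * x) * e232 + (((7 : ℂ) / 5) +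
          ((1 : ℂ) / 2) * x + ((-1 : ℂ) / 10) * x ^ (2 : ℕ) + ((-1 : ℂ) / 10) * x ^ (3 : ℕ)) * e240
    exact (mul_eq_zero.1 h).resolve_left hx8
  · have h : x ^ (8 : ℕ) * d2 = 0 := by
      linear_combination (((-1 : ℂ) / 2) + ((6 : ℂ) / 5) * x + ((7 : ℂ) / 10) * x ^ (2 : ℕ) + ((-17 : ℂ) / 5) * x ^ (3 : ℕ) + x ^ (4 : ℕ) +
          -(x ^ (5 : ℕ)) + ((-3 : ℂ) / 10) * x ^ (6 : ℕ) + ((3 : ℂ) / 5) * x ^ (7 : ℕ)) * e210 + (((7 : ℂ) / 8) + ((19 : ℂ) / 10) * x +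
          ((12 : ℂ) / 5) * x ^ (2 : ℕ) + ((129 : ℂ) / 40) * x ^ (3 : ℕ) + ((-23 : ℂ) / 40) * x ^ (4 : ℕ) + ((3 : ℂ) / 40) * x ^ (5 : ℕ) +
          ((-3 : ℂ) / 20) * x ^ (6 : ℕ) + ((-9 : ℂ) / 20) * x ^ (7 : ℕ)) * e220 + (((1 : ℂ) / 8) + ((-9 : ℂ) / 10) * x + ((-8 : ℂ) / 5) * x ^ (2 : ℕ) +
          ((67 : ℂ) / 40) * x ^ (3 : ℕ) + ((-17 : ℂ) / 40) * x ^ (4 : ℕ) + ((1 : ℂ) / 40) * x ^ (5 : ℕ) + ((9 : ℂ) / 20) * x ^ (6 : ℕ) +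
          ((-3 : ℂ) / 20) * x ^ (7 : ℕ)) * e221 + (((-103 : ℂ) / 40) + ((-129 : ℂ) / 40) * x + ((-31 : ℂ) / 10) * x ^ (2 : ℕ) +
          ((-7 : ℂ) / 10) * x ^ (3 : ℕ) + ((9 : ℂ) / 10) * x ^ (4 : ℕ) + ((3 : ℂ) / 5) * x ^ (5 : ℕ)) * e230 + (((-1 : ℂ) / 2) + ((6 : ℂ) / 5) * x +
          ((19 : ℂ) / 10) * x ^ (2 : ℕ) + ((-1 : ℂ) / 2) * x ^ (3 : ℕ) + ((-9 : ℂ) / 10) * x ^ (4 : ℕ) + ((3 : ℂ) / 10) * x ^ (5 : ℕ)) * e231 +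
          (((3 : ℂ) / 8) + ((-27 : ℂ) / 40) * x) * e232 + (((11 : ℂ) / 5) + ((1 : ℂ) / 2) * x + ((-3 : ℂ) / 10) * x ^ (2 : ℕ) +
          ((-3 : ℂ) / 10) * x ^ (3 : ℕ)) * e240
    exact (mul_eq_zero.1 h).resolve_left hx8
  · have h : x ^ (8 : ℕ) * d3 = 0 := by
      linear_combination (((9 : ℂ) / 10) * x + ((-1 : ℂ) / 10) * x ^ (2 : ℕ) + ((-14 : ℂ) / 5) * x ^ (3 : ℕ) + -(x ^ (5 : ℕ)) +
          ((-1 : ℂ) / 10) * x ^ (6 : ℕ) + ((1 : ℂ) / 5) * x ^ (7 : ℕ)) * e210 + (((3 : ℂ) / 8) + ((31 : ℂ) / 20) * x + ((51 : ℂ) / 20) * x ^ (2 : ℕ) +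
          ((123 : ℂ) / 40) * x ^ (3 : ℕ) + ((9 : ℂ) / 40) * x ^ (4 : ℕ) + ((21 : ℂ) / 40) * x ^ (5 : ℕ) + ((-1 : ℂ) / 20) * x ^ (6 : ℕ) +
          ((-3 : ℂ) / 20) * x ^ (7 : ℕ)) * e220 + (((-3 : ℂ) / 8) + ((-11 : ℂ) / 20) * x + ((-19 : ℂ) / 20) * x ^ (2 : ℕ) +
          ((49 : ℂ) / 40) * x ^ (3 : ℕ) + ((-9 : ℂ) / 40) * x ^ (4 : ℕ) + ((7 : ℂ) / 40) * x ^ (5 : ℕ) + ((3 : ℂ) / 20) * x ^ (6 : ℕ) +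
          ((-1 : ℂ) / 20) * x ^ (7 : ℕ)) * e221 + (((-71 : ℂ) / 40) + ((-103 : ℂ) / 40) * x + ((-27 : ℂ) / 10) * x ^ (2 : ℕ) +
          ((-9 : ℂ) / 10) * x ^ (3 : ℕ) + ((3 : ℂ) / 10) * x ^ (4 : ℕ) + ((1 : ℂ) / 5) * x ^ (5 : ℕ)) * e230 + (((9 : ℂ) / 10) * x +
          ((13 : ℂ) / 10) * x ^ (2 : ℕ) + ((-1 : ℂ) / 2) * x ^ (3 : ℕ) + ((-3 : ℂ) / 10) * x ^ (4 : ℕ) + ((1 : ℂ) / 10) * x ^ (5 : ℕ)) * e231 +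
          (((3 : ℂ) / 8) + ((-29 : ℂ) / 40) * x) * e232 + (((7 : ℂ) / 5) + ((1 : ℂ) / 2) * x + ((-1 : ℂ) / 10) * x ^ (2 : ℕ) +
          ((-1 : ℂ) / 10) * x ^ (3 : ℕ)) * e240
    exact (mul_eq_zero.1 h).resolve_left hx8

end NoBoundaryRelation

/-- **Width two already refuses.** For every fugacity `x ≠ 0`: if constants `c₀, c_W, c_E, c_N, c_S` make
`c₀ x + c_W A + c_E B + c_N E + c_S Ē = 0` hold on all `ℤ²` rectangles of WIDTH `2` with all west pendant
roots, then all five vanish (seven rectangles of heights `≤ 4` suffice). Hence no `T`-dependent constants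
make the finite-`L` Duminil-Copin–Smirnov/Beaton–Guttmann–Jensen identity exact at `T = 2` on the square
lattice; width `1` is genuinely different (identities `B = A + x`, `x(E + Ē) + (1 - x)A = 2x²`, module
docstring). [cite: BeatonGuttmannJensen2012, p. 5 (`T`-dependent constants `c_α(T)`, `c_β(T)`; square-lattice finite-width identity refuted here)]
[cite: DuminilCopinSmirnov2012, §3, Lemma 2 (the honeycomb identity, every `T`)] -/
theorem exactStripRelationZ2W_two_eq_zero {x : ℝ} {c₀ : ℂ} {c : Fin 4 → ℂ} (hx : x ≠ 0)
    (h : ExactStripRelationZ2W 2 x c₀ c) : c₀ = 0 ∧ c = 0 := by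
  obtain ⟨h0, h1, h2, h3, h4⟩ := NoBoundaryRelation.strip_core_w2 (x := (x : ℂ)) (by exact_mod_cast hx)
    (NoBoundaryRelation.instWS210 h) (NoBoundaryRelation.instWS220 h) (NoBoundaryRelation.instWS221 h)
    (NoBoundaryRelation.instWS230 h) (NoBoundaryRelation.instWS231 h) (NoBoundaryRelation.instWS232 h)
    (NoBoundaryRelation.instWS240 h)
  exact ⟨h0, by funext i; fin_cases i <;> simp [h1, h2, h3, h4]⟩

/-- The parent module's all-widths statement `exactStripRelationZ2_eq_zero`, re-derived from width `2` alone.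
[cite: BeatonGuttmannJensen2012, p. 5] -/
theorem exactStripRelationZ2_eq_zero_of_width_two {x : ℝ} {c₀ : ℂ} {c : Fin 4 → ℂ} (hx : x ≠ 0)
    (h : ExactStripRelationZ2 x c₀ c) : c₀ = 0 ∧ c = 0 :=
  exactStripRelationZ2W_two_eq_zero hx (h.width two_pos)

end Literature.Barriers.CriticalPhenomena
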